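import Literature.MathematicalPhysics.QuantumFieldTheory.Balaban1983to89.B9Eq387IMSAssembly

/-!
# `Balaban1983to89.B9Eq387IMSAssemblyRows` — T. Bałaban, *Propagators for lattice gauge theories in a background field*, Commun. Math. Phys. **99**
# (1985) 389–434 [Balaban1985BackgroundPropagators] p. 408 («Σ_□ h²_□ = 1»), (3.87)–(3.89) p. 409, (3.26) p. 395: **KERNEL 7's IMS ASSEMBLY FROM
# PRE-COMBINED ROWS** — the strong assembly `B9Eq387IMSAssembly.ims_assembly_strong` restated with, per local letter, ONE displayed row
# `Σ_j ‖T_i(χ_jx)‖² ≤ ‖T_ix‖² + b_i‖x‖²` (the shape the lattice files `B9Eq387IMSLocalLettersLattice` §3 ∕ `B9Eq387IMSAveragingLettersLattice` §2 ∕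
# `B9Eq387IMSAveragingLettersBackground` PRODUCE, `b_i = t_ik_i + a_i`) and ONE row `‖Wx‖² ≤ Σ_j ‖W(χ_jx)‖² + b_W‖x‖²` for the non-local letter:
# `γ₁Σ_i ‖T_ix‖² + (γ₀ − b_W − (1 − γ₁)Σ_i b_i)‖x‖² ≤ Σ_i ‖T_ix‖² − ‖Wx‖²` — route R2′ STEP B8′ (S-P7), the socket of the instance theorem (ledger row L11)

statement-level skeleton of published theorems with citation tags; proofs where landed; nothing here is a claim about the Yang–Mills mass gap

CITATION HEADER (lean-in-tree rule).  Audit cell `pub-balaban`, sub-cell `t4`, BINDER row NE9; filed by NE9 formalisation-swarm LEAF PROVER 01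
(`b2b-balaban-t4-ne9-formalise-leaf-01`, gen 82), the lineage of `B9Eq387IMSAssembly` (t4-ne9-idea-1 gen 92's kernel 7, ported verbatim by gen 80).  Source
READ: [Balaban1985BackgroundPropagators] p. 408, p. 409 (3.87)–(3.89) as quoted in the parent's header; the IMS bookkeeping is the ROUTE's device, NOT
print's road (parametrices + random walks); nothing of [B9] is asserted.

WHY.  `ims_assembly_strong` takes the (dn) shape in THREE pieces (`‖T_ix‖·‖K_ix‖`, `Σ_j ‖AD_ijx‖²`, with letters `t_i`, `k_i`, `a_i`) — the form in which
the cross term's `η`-cancellation `t_ik_i` is visible.  The lattice rows landed since are ALREADY COMBINED: (D) `sum_norm_sq_covCurl_localised_le` ∕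
`…covDiv…` give `Σ_j ‖T(χ_S^jA)‖² ≤ ‖TA‖² + (…)‖A‖²` for `T₁`, `T₂`, and the `T₃` files give the same for `Q(1)` ∕ `Q(U)`.  This file is the two-line
re-assembly that consumes rows directly, so that the instance theorem (ledger row L11) is ONE application once the non-local row (`b_W = C_Wk_W`, S-P5(b))
and the local coercivity (loc) are supplied.

WHAT IS PROVED (sorry-free; proof lane — no `def`; [folklore] finite sums + one multiplication by `1 − γ₁ ≥ 0`; norm-only, as the parent).
* **`ims_assembly_strong_of_rows`** — `Σ_j ‖χ_jx‖² = ‖x‖²`, rows `Σ_j ‖T_i(χ_jx)‖² ≤ ‖T_ix‖² + b_i‖x‖²` (every `i`), `‖Wx‖² ≤ Σ_j ‖W(χ_jx)‖² + b_W‖x‖²`,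
  `γ₁ ≤ 1`, (loc) `γ₁Σ_i ‖T_i(χ_jx)‖² + γ₀‖χ_jx‖² ≤ Σ_i ‖T_i(χ_jx)‖² − ‖W(χ_jx)‖²` (every `j ∈ s`) ⟹
  `γ₁Σ_i ‖T_ix‖² + (γ₀ − b_W − (1 − γ₁)Σ_i b_i)‖x‖² ≤ Σ_i ‖T_ix‖² − ‖Wx‖²`.
* `ims_assembly_of_rows` — the plain case `γ₁ = 0`.  §2 `row_smul` (a row for `T` gives the row for `c•T` with `‖c‖²b` — the `√a` of `T₃`).  §3 non-vacuity.
HONEST SCOPE.  Bookkeeping; no letter is estimated here; S-sized glue; NOT NE9 (cell pub-balaban: NE9 NOT PRINTED ∕ NOT PROVED; «NE9 ⇐ the named binders»;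
row WALLED ON A MODEL (O-NE9-1); spine PROVED 0∕9; rung (B)+1 on a finite T⁴ — NOT infinite volume, NOT mass gap, NOT Clay; HONEST DEPENDENCY: continuum YM on
T⁴ ⇐ BetaPertH ∧ nine spine estimates (0/9 proved); BetaPertH ⇐ (D1) ∧ (D4) ∧ CAP+tail; G-an2-4 gates asym, D1 and NE2/3/4).  NEW file importing
`B9Eq387IMSAssembly` only; nothing modified.  Net new unproved facts: 0.
-/

namespace Literature.MathematicalPhysics.QuantumFieldTheory.Balaban1983to89.B9Eq387IMSAssemblyRows

open scoped BigOperators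

/-! ## §1 The strong assembly from pre-combined rows -/

/-- **THE IMS ASSEMBLY FROM ROWS, STRONG FORM**: for a quadratic partition with `Σ_j ‖χ_jx‖² = ‖x‖²`, local letters `T_i` with combined (dn) rows
`Σ_j ‖T_i(χ_jx)‖² ≤ ‖T_ix‖² + b_i‖x‖²`, a non-local letter with (up) row `‖Wx‖² ≤ Σ_j ‖W(χ_jx)‖² + b_W‖x‖²`, `γ₁ ≤ 1` and local strong coercivity
`γ₁Σ_i ‖T_i(χ_jx)‖² + γ₀‖χ_jx‖² ≤ Σ_i ‖T_i(χ_jx)‖² − ‖W(χ_jx)‖²`: `γ₁Σ_i ‖T_ix‖² + (γ₀ − b_W − (1 − γ₁)Σ_i b_i)‖x‖² ≤ Σ_i ‖T_ix‖² − ‖Wx‖²`.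
[folklore] (IMS localisation bookkeeping) [cite: Balaban1985BackgroundPropagators, p.408, (3.87)–(3.89) p.409, (3.26) p.395] -/
theorem ims_assembly_strong_of_rows
    {ι J S F : Type*} [Fintype ι] [NormedAddCommGroup S] [NormedAddCommGroup F]
    {E : ι → Type*} [∀ i, NormedAddCommGroup (E i)]
    (s : Finset J) (χ : J → S → S) (T : ∀ i, S → E i) (W : S → F) {b : ι → ℝ} {bW γ₁ γ₀ : ℝ}
    (hχ : ∀ x, ∑ j ∈ s, ‖χ j x‖ ^ 2 = ‖x‖ ^ 2)
    (hrow : ∀ i x, ∑ j ∈ s, ‖T i (χ j x)‖ ^ 2 ≤ ‖T i x‖ ^ 2 + b i * ‖x‖ ^ 2)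
    (hWrow : ∀ x, ‖W x‖ ^ 2 ≤ ∑ j ∈ s, ‖W (χ j x)‖ ^ 2 + bW * ‖x‖ ^ 2) (hγ₁ : γ₁ ≤ 1)
    (hloc : ∀ j ∈ s, ∀ x, γ₁ * ∑ i, ‖T i (χ j x)‖ ^ 2 + γ₀ * ‖χ j x‖ ^ 2 ≤ ∑ i, ‖T i (χ j x)‖ ^ 2 - ‖W (χ j x)‖ ^ 2)
    (x : S) :
    γ₁ * ∑ i, ‖T i x‖ ^ 2 + (γ₀ - bW - (1 - γ₁) * ∑ i, b i) * ‖x‖ ^ 2 ≤ ∑ i, ‖T i x‖ ^ 2 - ‖W x‖ ^ 2 := by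
  -- sum the rows over the letters and exchange the two finite sums
  have hP : ∑ j ∈ s, ∑ i, ‖T i (χ j x)‖ ^ 2 ≤ ∑ i, ‖T i x‖ ^ 2 + (∑ i, b i) * ‖x‖ ^ 2 := by
    rw [Finset.sum_comm, Finset.sum_mul, ← Finset.sum_add_distrib]
    exact Finset.sum_le_sum fun i _ => hrow i x
  -- (loc) summed over the cubes, with `Σ_j ‖χ_j x‖² = ‖x‖²`
  have hl : γ₁ * ∑ j ∈ s, ∑ i, ‖T i (χ j x)‖ ^ 2 + γ₀ * ‖x‖ ^ 2
      ≤ ∑ j ∈ s, ∑ i, ‖T i (χ j x)‖ ^ 2 - ∑ j ∈ s, ‖W (χ j x)‖ ^ 2 := by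
    have := Finset.sum_le_sum fun j hj => hloc j hj x
    rw [Finset.sum_add_distrib, ← Finset.mul_sum, ← Finset.mul_sum, hχ x, Finset.sum_sub_distrib] at this
    exact this
  have h5 : (1 - γ₁) * ∑ j ∈ s, ∑ i, ‖T i (χ j x)‖ ^ 2 ≤ (1 - γ₁) * (∑ i, ‖T i x‖ ^ 2 + (∑ i, b i) * ‖x‖ ^ 2) :=
    mul_le_mul_of_nonneg_left hP (sub_nonneg.mpr hγ₁)
  nlinarith [h5, hl, hWrow x]

/-- **THE IMS ASSEMBLY FROM ROWS, PLAIN FORM** (`γ₁ = 0`): `(γ₀ − b_W − Σ_i b_i)‖x‖² ≤ Σ_i ‖T_ix‖² − ‖Wx‖²`. [folklore]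
[cite: Balaban1985BackgroundPropagators, p.408, (3.87)–(3.89) p.409, (3.26) p.395] -/
theorem ims_assembly_of_rows
    {ι J S F : Type*} [Fintype ι] [NormedAddCommGroup S] [NormedAddCommGroup F]
    {E : ι → Type*} [∀ i, NormedAddCommGroup (E i)]
    (s : Finset J) (χ : J → S → S) (T : ∀ i, S → E i) (W : S → F) {b : ι → ℝ} {bW γ₀ : ℝ}
    (hχ : ∀ x, ∑ j ∈ s, ‖χ j x‖ ^ 2 = ‖x‖ ^ 2)
    (hrow : ∀ i x, ∑ j ∈ s, ‖T i (χ j x)‖ ^ 2 ≤ ‖T i x‖ ^ 2 + b i * ‖x‖ ^ 2)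
    (hWrow : ∀ x, ‖W x‖ ^ 2 ≤ ∑ j ∈ s, ‖W (χ j x)‖ ^ 2 + bW * ‖x‖ ^ 2)
    (hloc : ∀ j ∈ s, ∀ x, γ₀ * ‖χ j x‖ ^ 2 ≤ ∑ i, ‖T i (χ j x)‖ ^ 2 - ‖W (χ j x)‖ ^ 2)
    (x : S) :
    (γ₀ - bW - ∑ i, b i) * ‖x‖ ^ 2 ≤ ∑ i, ‖T i x‖ ^ 2 - ‖W x‖ ^ 2 := by
  have h := ims_assembly_strong_of_rows s χ T W (γ₁ := 0) (γ₀ := γ₀) hχ hrow hWrow zero_le_one (fun j hj y => by simpa using hloc j hj y) x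
  simpa using h

/-! ## §2 Rows scale with the letter: `T ↦ c•T` multiplies the row constant by `‖c‖²` (kernel 7's `T₃ = √a·Q`) -/

/-- **A (dn) ROW SCALES**: if `Σ_j ‖T(χ_jx)‖² ≤ ‖Tx‖² + b‖x‖²` then for any scalar `c` of a normed field acting on the target,
`Σ_j ‖c•T(χ_jx)‖² ≤ ‖c•Tx‖² + ‖c‖²b·‖x‖²` — the weight `√a` of kernel 7's third letter enters the assembly as `a·b₃`. [folklore]
[cite: Balaban1985BackgroundPropagators, (3.26) p.395, p.408] -/
theorem row_smul {𝕜 S E : Type*} [NormedField 𝕜] [NormedAddCommGroup S] [SeminormedAddCommGroup E] [NormedSpace 𝕜 E]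
    {J : Type*} (s : Finset J) (χ : J → S → S) (T : S → E) {b : ℝ} (c : 𝕜)
    (hrow : ∀ x, ∑ j ∈ s, ‖T (χ j x)‖ ^ 2 ≤ ‖T x‖ ^ 2 + b * ‖x‖ ^ 2) (x : S) :
    ∑ j ∈ s, ‖c • T (χ j x)‖ ^ 2 ≤ ‖c • T x‖ ^ 2 + ‖c‖ ^ 2 * b * ‖x‖ ^ 2 := by
  have h := mul_le_mul_of_nonneg_left (hrow x) (sq_nonneg ‖c‖)
  simp only [norm_smul, mul_pow, ← Finset.mul_sum]
  linarith

/-! ## §3 Non-vacuity -/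

/-- One letter `T = id` on `ℝ`, one cube `χ = id`, `W = 0`, rows `b = b_W = 0`: the hypotheses hold with `γ₁ = γ₀ = ½` and the conclusion is an equality.
[folklore] [cite: Balaban1985BackgroundPropagators, p.408] -/
example (x : ℝ) :
    (1 / 2 : ℝ) * ∑ _i : Unit, ‖(fun (_ : Unit) (y : ℝ) => y) () x‖ ^ 2 + ((1 / 2 : ℝ) - 0 - (1 - 1 / 2) * ∑ _i : Unit, (0 : ℝ)) * ‖x‖ ^ 2
      ≤ ∑ _i : Unit, ‖(fun (_ : Unit) (y : ℝ) => y) () x‖ ^ 2 - ‖(fun _ : ℝ => (0 : ℝ)) x‖ ^ 2 :=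
  ims_assembly_strong_of_rows (ι := Unit) (J := Unit) (S := ℝ) (F := ℝ) (E := fun _ => ℝ)
    (Finset.univ : Finset Unit) (fun _ y => y) (fun _ y => y) (fun _ => (0 : ℝ)) (b := fun _ => 0) (bW := 0) (γ₁ := 1 / 2) (γ₀ := 1 / 2)
    (by intro y; simp) (by intro i y; simp) (by intro y; simp) (by norm_num) (by intro j _ y; simp; ring_nf; exact le_rfl) x

end Literature.MathematicalPhysics.QuantumFieldTheory.Balaban1983to89.B9Eq387IMSAssemblyRows
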